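import Literature.NumberTheory.Automorphic.UnitaryGroupTruncatedKernelClassIntegrableHolds
import Literature.NumberTheory.Automorphic.UnitaryGroupTruncatedKernelClassMeasurable
import HarnessLib

/-!
# The lattice-sum remainder `R_T = Σ_{δ ∈ B(F)\G(F)} 1_{T<H(δx)} (K_{B,𝔬} − Σ_{B(F)∩𝔬̲})(δx)` of a class
# truncated kernel on `U(3)` COLLAPSES to `−1_{H^G > T} · k^T_𝔬`: integrability, and `J^T_𝔬` as the naively
# truncated class kernel minus `∫ R_T`
(Rogawski, *Automorphic Representations of Unitary Groups in Three Variables* (1990), §2.2 p. 13 (`K_{P,𝔬}`,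
`k^T_𝔬`), §6.1 pp. 79–81 (the hyperbolic term as a weighted orbital integral); Arthur, *A trace formula for
reductive groups I*, Duke Math. J. 45 (1978), §8 (the regrouping of `k^T_𝔬` for an unramified class);
Gelbart, *Automorphic forms on adele groups* (1975), §9.B)

Topic `NumberTheory/Automorphic`; namespace `Literature.NumberTheory.Automorphic.UnitaryGroup`. THEOREMS ONLY
over accepted tree modules: no definition, no named fact, no instance, no notation, no `sorry`. Item (L5-ii)
**(W2-b) FILE 1** of the T1-qs LAW 5 road (`Cruxes/H413/Lines/F0_T1InnerFormTraceIdentity.lean`, cell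
`pub/hodgecm-mathlib`, crux H413; F0P3a-p05 (g6) WORDS 11:31:04Z, letters verbatim): with

  `D_𝔬(y) := K_{B,𝔬}(y, y) − Σ_{β ∈ B(F) ∩ 𝔬̲} f(y⁻¹ β y)`
    (`= kernelBorelClass ν 𝓕 cl i f y y − borelSumClass cl i f y y`, «adelic `N`-average minus `B(F)∩𝔬̲`-lattice sum»),
  `R_T(x) := Σ_{δ ∈ B(F)\G(F)} 1_{T < H(δx)} D_𝔬(δx)` (`= pseudoEisenstein ({y | T < borelHeight y}.indicator D_𝔬) x`),

the regrouping of the class truncated kernel `k^T_𝔬 = K_𝔬 − Σ_δ 1_{T<H(δ·)} K_{B,𝔬}(δ·, δ·)` as «`j`-kernel minus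
`R_T`» ([Arthur1978] §8; [Rogawski1990] §6.1) isolates `R_T` as the term whose integral over `G(F)\G(𝔸_F)` must
vanish. THIS FILE proves that `R_T` is nothing but the class truncated kernel CUT OFF TO THE CUSP:

* §1 (`N = 3`, every class map with Rogawski's two axioms, every class) for `T ≥ 1` above the threshold `c₀(f)`
  of ★ `exists_forall_kernelClass_eq_borelSumClass_of_lt_borelHeight`:
  **`indicator_kernelBorelClass_sub_borelSumClass_eq_neg`** — `1_{T<H} · D_𝔬 = −1_{T<H} · k^T_𝔬` (on `{T < H}`:
  `Σ_{B(F)∩𝔬̲} = K_𝔬` and `k^T_𝔬 = K_𝔬 − K_{B,𝔬}`, ★ `truncatedKernelClass_eq_kernelClass_sub_kernelBorelClass`);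
  **`pseudoEisenstein_indicator_eq_indicator_of_rational_mul`** — for a left-`G(F)`-INVARIANT `φ` and `T ≥ 1`,
  `Σ_δ 1_{T<H(δx)} φ(δx) = 1_{∃ γ ∈ G(F), T < H(γx)} · φ(x)` (Siegel: at most one coset is high in the cusp,
  ★ `not_lt_borelHeight_mul_of_not_mem_arithmeticBorel`); hence **`pseudoEisenstein_indicator_kernelBorelClass_sub_borelSumClass_eq`**:
  `R_T = −1_{H^G > T} · k^T_𝔬` with `{H^G > T} := {x | ∃ γ ∈ G(F), T < H(γx)}`.
* §2 measurability: `measurableSet_setOf_exists_lt_borelHeight_mul` (a countable union of translates of `{T < H}`),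
  `measurable_quotFun_pseudoEisenstein_indicator_kernelBorelClass_sub_borelSumClass` (honest descent to
  `G(𝔸_F) ⧸ G(F)`, as ★ `measurable_quotFun_truncatedKernelClass`).
* §3 **(W2-b)(i) INTEGRABILITY**: `integrable_quotFun_pseudoEisenstein_indicator_of_integrable` — `[g] ↦ R_T(g⁻¹)`
  is `μ`-integrable as soon as `[g] ↦ k^T_𝔬(g⁻¹)` is (domination by §1); **`integrable_quotFun_pseudoEisenstein_indicator_cm`**
  — at the CM pair `(L⁺, L, complexConj)`, for every test function and class, for all `T > T₁(f, 𝔬)`, NO further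
  hypothesis (★ `truncatedKernelClassIntegrable_cm`).
* §4 **`truncatedTraceClass_eq_integral_indicator_sub_integral_pseudoEisenstein`** — `J^T_𝔬(f) = ∫ 1_{H^G ≤ T} K_𝔬 − ∫ R_T`:
  below the cut-off `k^T_𝔬 = K_𝔬` (★ `truncatedKernelClass_eq_kernelClass_of_forall_le`), above it `k^T_𝔬 = −R_T`;
  so the VANISHING `∫ R_T = 0` (sequel (W2-b) FILE 3, for `N`-regular classes) is exactly «naive truncation
  computes `J^T_𝔬(f)`».

HONEST LABEL: no printed statement is consumed; HC_CM is proved only modulo the printed citations until rung 0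
closes.

## References

* J. D. Rogawski, *Automorphic Representations of Unitary Groups in Three Variables*, Annals of Mathematics
  Studies 123 (1990), §2.2 (p. 13), §6.1 (pp. 79–81) [Rogawski1990].
* J. Arthur, *A trace formula for reductive groups I: terms associated to classes in `G(ℚ)`*, Duke Math. J. 45
  (1978), §8 [Arthur1978TraceFormulaI].
* S. Gelbart, *Automorphic forms on adele groups*, Annals of Mathematics Studies 83 (1975), §9.B [Gelbart1975].
-/

set_option autoImplicit false

noncomputable section

open MeasureTheory Measure NumberField IsDedekindDomain Set
open scoped NNReal ENNReal

namespace Literature.NumberTheory.Automorphic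

namespace UnitaryGroup

variable {F E : Type} [Field F] [NumberField F] [Field E] [NumberField E] [Algebra F E]
  {c : E ≃ₐ[F] E} {N : ℕ} {ι : Type*}

/-- `𝔸_E` is Hausdorff (local copy of the standard three-line argument). [folklore] -/
private theorem t2Space_adeleRing_E₁₂ : T2Space (AdeleRing (𝓞 E) E) := by
  haveI : T2Space (FiniteAdeleRing (𝓞 E) E) := inferInstanceAs <| T2Space
    (RestrictedProduct (fun w : HeightOneSpectrum (𝓞 E) => w.adicCompletion E)
      (fun w => (w.adicCompletionIntegers E : Set (w.adicCompletion E))) Filter.cofinite)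
  haveI : T2Space (InfiniteAdeleRing E) :=
    inferInstanceAs <| T2Space ((w : InfinitePlace E) → w.Completion)
  exact inferInstanceAs <| T2Space (InfiniteAdeleRing E × FiniteAdeleRing (𝓞 E) E)

/-- `G(F)` is countable (★ `countable_quotientSubgroup_quasiSplit` through `A_G · G(F) = G(F)`). [folklore] -/
private theorem countable_arithmeticSubgroup₁₂ : Countable (quasiSplit F E c N).arithmeticSubgroup := by
  rw [← quotientSubgroup_quasiSplit]; exact countable_quotientSubgroup_quasiSplit

/-! ## §1 The collapse `R_T = −1_{H^G > T} · k^T_𝔬` -/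

section General

/-- **A pseudo-Eisenstein sum of a cusp cut-off of a `G(F)`-INVARIANT function collapses** (`U(J₃)`, `T ≥ 1`):
`Σ_{δ ∈ B(F)\G(F)} 1_{T < H(δx)} φ(δx) = 1_{∃ γ ∈ G(F), T < H(γx)} · φ(x)` — by the Siegel property ★
`not_lt_borelHeight_mul_of_not_mem_arithmeticBorel` at most ONE right coset `B(F)δ` has `H(δx) > T ≥ 1`, and on
it `φ(δx) = φ(x)` (Gelbart (1975), §9.B; Arthur (1978), §8: the reduction theory behind the unfolding of the
parabolic terms). [cite: Gelbart1975, §9.B] [cite: Arthur1978TraceFormulaI, §8] -/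
theorem pseudoEisenstein_indicator_eq_indicator_of_rational_mul {φ : (quasiSplit F E c 3).Adelic → ℂ}
    (hφ : ∀ (γ : (quasiSplit F E c 3).arithmeticSubgroup) (y : (quasiSplit F E c 3).Adelic),
      φ ((γ : (quasiSplit F E c 3).Adelic) * y) = φ y)
    {T : ℝ≥0} (hT : 1 ≤ T) (x : (quasiSplit F E c 3).Adelic) :
    pseudoEisenstein ({y : (quasiSplit F E c 3).Adelic | T < borelHeight y}.indicator φ) x =
      {x : (quasiSplit F E c 3).Adelic | ∃ γ : (quasiSplit F E c 3).arithmeticSubgroup,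
          T < borelHeight ((γ : (quasiSplit F E c 3).Adelic) * x)}.indicator φ x := by
  classical
  set C : Set (quasiSplit F E c 3).Adelic := {y | T < borelHeight y} with hC
  set S : Set (quasiSplit F E c 3).Adelic := {x | ∃ γ : (quasiSplit F E c 3).arithmeticSubgroup,
    T < borelHeight ((γ : (quasiSplit F E c 3).Adelic) * x)} with hS
  rw [pseudoEisenstein_def]
  by_cases hx : x ∈ S
  · obtain ⟨γ₀, hγ₀⟩ := hx
    rw [Set.indicator_of_mem (show x ∈ S from ⟨γ₀, hγ₀⟩) φ]
    set q₀ : Quotient (QuotientGroup.rightRel (arithmeticBorel F E c 3)) :=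
      Quotient.mk (QuotientGroup.rightRel (arithmeticBorel F E c 3)) γ₀ with hq₀
    -- every coset high in the cusp is `q₀`
    have huniq : ∀ q : Quotient (QuotientGroup.rightRel (arithmeticBorel F E c 3)),
        ((q.out : (quasiSplit F E c 3).arithmeticSubgroup) : (quasiSplit F E c 3).Adelic) * x ∈ C → q = q₀ := by
      intro q hq
      have hmem : q.out * γ₀⁻¹ ∈ arithmeticBorel F E c 3 := by
        by_contra hnot
        refine not_lt_borelHeight_mul_of_not_mem_arithmeticBorel hnot hT hγ₀ ?_
        have h : ((q.out * γ₀⁻¹ : (quasiSplit F E c 3).arithmeticSubgroup) : (quasiSplit F E c 3).Adelic) *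
            (((γ₀ : (quasiSplit F E c 3).arithmeticSubgroup) : (quasiSplit F E c 3).Adelic) * x) =
            ((q.out : (quasiSplit F E c 3).arithmeticSubgroup) : (quasiSplit F E c 3).Adelic) * x := by
          rw [Subgroup.coe_mul, Subgroup.coe_inv, mul_assoc, inv_mul_cancel_left]
        rw [h]
        exact hq
      rw [← Quotient.out_eq q, hq₀]
      exact Quotient.sound (QuotientGroup.rightRel_apply.2 (by
        have h := Subgroup.inv_mem _ hmem
        rwa [mul_inv_rev, inv_inv] at h))
    rw [finsum_eq_single _ q₀ (fun q hq => Set.indicator_of_notMem (s := C) (fun hmem => hq (huniq q hmem)) φ)]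
    -- the `q₀`-term: `q₀.out = b γ₀` with `b ∈ B(F)`, so it is high in the cusp and `φ(q₀.out x) = φ x`
    have hrel : q₀.out * γ₀⁻¹ ∈ arithmeticBorel F E c 3 := by
      have h : @Setoid.r _ (QuotientGroup.rightRel (arithmeticBorel F E c 3)) q₀.out γ₀ :=
        Quotient.exact (by rw [Quotient.out_eq, hq₀])
      rw [QuotientGroup.rightRel_apply] at h
      have h' := Subgroup.inv_mem _ h
      rwa [mul_inv_rev, inv_inv] at h'
    have hhigh : ((q₀.out : (quasiSplit F E c 3).arithmeticSubgroup) : (quasiSplit F E c 3).Adelic) * x ∈ C := by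
      obtain ⟨b, hb⟩ := (q₀.out * γ₀⁻¹ : (quasiSplit F E c 3).arithmeticSubgroup).2
      have hbB : (quasiSplit F E c 3).toAdelic b ∈ borelAdelic F E c 3 := by
        rw [hb]; exact (mem_arithmeticBorel_iff _).1 hrel
      have heq : ((q₀.out : (quasiSplit F E c 3).arithmeticSubgroup) : (quasiSplit F E c 3).Adelic) * x =
          (quasiSplit F E c 3).toAdelic b * (((γ₀ : (quasiSplit F E c 3).arithmeticSubgroup) : (quasiSplit F E c 3).Adelic) * x) := by
        rw [hb, Subgroup.coe_mul, Subgroup.coe_inv, mul_assoc, inv_mul_cancel_left]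
      change T < borelHeight _
      rw [heq, borelHeight_rational_borel_mul b hbB]
      exact hγ₀
    rw [Set.indicator_of_mem hhigh φ, hφ]
  · rw [Set.indicator_of_notMem hx φ]
    exact finsum_eq_zero_of_forall_eq_zero fun q =>
      Set.indicator_of_notMem (s := C) (fun hq => hx ⟨q.out, hq⟩) φ

/-- The cusp set `{x | ∃ γ ∈ G(F), T < H(γx)}` is left `G(F)`-invariant. [cite: Gelbart1975, §9.B] -/
theorem exists_lt_borelHeight_rational_mul_iff [NeZero N] (T : ℝ≥0) (γ₀ : (quasiSplit F E c N).arithmeticSubgroup)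
    (x : (quasiSplit F E c N).Adelic) :
    (∃ γ : (quasiSplit F E c N).arithmeticSubgroup,
        T < borelHeight ((γ : (quasiSplit F E c N).Adelic) * (((γ₀ : (quasiSplit F E c N).Adelic)) * x))) ↔
      ∃ γ : (quasiSplit F E c N).arithmeticSubgroup, T < borelHeight ((γ : (quasiSplit F E c N).Adelic) * x) := by
  constructor
  · rintro ⟨γ, hγ⟩
    exact ⟨γ * γ₀, by rwa [Subgroup.coe_mul, mul_assoc]⟩
  · rintro ⟨γ, hγ⟩
    exact ⟨γ * γ₀⁻¹, by rwa [Subgroup.coe_mul, Subgroup.coe_inv, mul_assoc, inv_mul_cancel_left]⟩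

variable [MeasurableSpace (adelicUnipotent F E c 3)] [BorelSpace (adelicUnipotent F E c 3)]

/-- **On the cusp cut-off the lattice-sum remainder IS minus the class truncated kernel**: for `U(J₃)`, a class map
with Rogawski's two axioms, a Haar measure `ν` of `N(𝔸_F)`, a fundamental domain `𝓕` of `N(F)`, and `T ≥ 1`,
`T ≥ c₀` where `c₀` is a threshold above which `K_𝔬(g, g) = Σ_{β ∈ B(F)∩𝔬̲} f(g⁻¹βg)` (★
`exists_forall_kernelClass_eq_borelSumClass_of_lt_borelHeight`):
`1_{T<H(y)} · (K_{B,𝔬}(y,y) − Σ_{B(F)∩𝔬̲} f(y⁻¹βy)) = −1_{T<H(y)} · k^T_𝔬(y)` — on `{T < H}` the class kernel is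
its Borel part and `k^T_𝔬 = K_𝔬 − K_{B,𝔬}` (★ `truncatedKernelClass_eq_kernelClass_sub_kernelBorelClass`).
[cite: Rogawski1990, §2.2 (p. 13)] [cite: Arthur1978TraceFormulaI, §8] -/
theorem indicator_kernelBorelClass_sub_borelSumClass_eq_neg
    {cl : (quasiSplit F E c 3).arithmeticSubgroup → ι} (hcl : IsConjInvariant cl)
    (hclN : IsUnipotentInvariantOnBorel F E c 3 cl) (ν : Measure (adelicUnipotent F E c 3)) [ν.IsHaarMeasure]
    {𝓕 : Set (adelicUnipotent F E c 3)} (h𝓕 : IsFundamentalDomain (rationalUnipotent F E c 3) 𝓕 ν) (i : ι)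
    {f : (quasiSplit F E c 3).Adelic → ℂ} {c₀ : ℝ≥0}
    (hc₀ : ∀ g : (quasiSplit F E c 3).Adelic, c₀ < borelHeight g → kernelClass cl i f g g = borelSumClass cl i f g g)
    {T : ℝ≥0} (hT : 1 ≤ T) (hTc : c₀ ≤ T) :
    {y : (quasiSplit F E c 3).Adelic | T < borelHeight y}.indicator
        (fun y => kernelBorelClass ν 𝓕 cl i f y y - borelSumClass cl i f y y) =
      -{y : (quasiSplit F E c 3).Adelic | T < borelHeight y}.indicator (truncatedKernelClass ν 𝓕 T cl i f) := by
  funext y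
  rw [Pi.neg_apply]
  by_cases hy : T < borelHeight y
  · rw [Set.indicator_of_mem (show y ∈ {y : (quasiSplit F E c 3).Adelic | T < borelHeight y} from hy),
      Set.indicator_of_mem (show y ∈ {y : (quasiSplit F E c 3).Adelic | T < borelHeight y} from hy),
      truncatedKernelClass_eq_kernelClass_sub_kernelBorelClass hcl hclN ν h𝓕 i f hT hy, hc₀ y (hTc.trans_lt hy)]
    ring
  · rw [Set.indicator_of_notMem (show y ∉ {y : (quasiSplit F E c 3).Adelic | T < borelHeight y} from hy),
      Set.indicator_of_notMem (show y ∉ {y : (quasiSplit F E c 3).Adelic | T < borelHeight y} from hy), neg_zero]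

/-- **THE COLLAPSE `R_T = −1_{H^G > T} · k^T_𝔬`**: for `U(J₃)`, a class map with Rogawski's two axioms, a Haar
measure `ν` of `N(𝔸_F)`, a fundamental domain `𝓕` of `N(F)`, `T ≥ 1` above the threshold `c₀` of the Borel
collapse of `K_𝔬`, and every `x`:
`Σ_{δ ∈ B(F)\G(F)} 1_{T<H(δx)} (K_{B,𝔬} − Σ_{B(F)∩𝔬̲})(δx) = −1_{∃ γ ∈ G(F), T < H(γx)} · k^T_𝔬(x)` — the previous
lemma, then the one-coset collapse of the pseudo-Eisenstein sum of the `G(F)`-invariant `k^T_𝔬` (★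
`truncatedKernelClass_rational_mul'`). [cite: Rogawski1990, §2.2 (p. 13); §6.1 (pp. 79–81)]
[cite: Arthur1978TraceFormulaI, §8] -/
theorem pseudoEisenstein_indicator_kernelBorelClass_sub_borelSumClass_eq
    {cl : (quasiSplit F E c 3).arithmeticSubgroup → ι} (hcl : IsConjInvariant cl)
    (hclN : IsUnipotentInvariantOnBorel F E c 3 cl) (ν : Measure (adelicUnipotent F E c 3)) [ν.IsHaarMeasure]
    {𝓕 : Set (adelicUnipotent F E c 3)} (h𝓕 : IsFundamentalDomain (rationalUnipotent F E c 3) 𝓕 ν) (i : ι)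
    {f : (quasiSplit F E c 3).Adelic → ℂ} {c₀ : ℝ≥0}
    (hc₀ : ∀ g : (quasiSplit F E c 3).Adelic, c₀ < borelHeight g → kernelClass cl i f g g = borelSumClass cl i f g g)
    {T : ℝ≥0} (hT : 1 ≤ T) (hTc : c₀ ≤ T) (x : (quasiSplit F E c 3).Adelic) :
    pseudoEisenstein ({y : (quasiSplit F E c 3).Adelic | T < borelHeight y}.indicator
        (fun y => kernelBorelClass ν 𝓕 cl i f y y - borelSumClass cl i f y y)) x =
      -{x : (quasiSplit F E c 3).Adelic | ∃ γ : (quasiSplit F E c 3).arithmeticSubgroup,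
          T < borelHeight ((γ : (quasiSplit F E c 3).Adelic) * x)}.indicator (truncatedKernelClass ν 𝓕 T cl i f) x := by
  rw [indicator_kernelBorelClass_sub_borelSumClass_eq_neg hcl hclN ν h𝓕 i hc₀ hT hTc,
    show -{y : (quasiSplit F E c 3).Adelic | T < borelHeight y}.indicator (truncatedKernelClass ν 𝓕 T cl i f) =
      (-1 : ℂ) • {y : (quasiSplit F E c 3).Adelic | T < borelHeight y}.indicator (truncatedKernelClass ν 𝓕 T cl i f)
      from (neg_one_smul ℂ _).symm, pseudoEisenstein_smul,
    pseudoEisenstein_indicator_eq_indicator_of_rational_mul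
      (fun γ y => truncatedKernelClass_rational_mul' hcl hclN ν h𝓕 T i f γ y) hT, neg_one_mul]

/-- **The descended remainder**: on the automorphic quotient, `[g] ↦ R_T(g⁻¹)` is
`−1_{[g] : ∃ γ, T < H(γ g⁻¹)} · ([g] ↦ k^T_𝔬(g⁻¹))` (`AdelicGroupData.quotFun` unfolds to evaluation at
`(out [g])⁻¹`; both sides are honest descents). [cite: Rogawski1990, §2.2 (p. 13); §6.1 (pp. 79–81)] -/
theorem quotFun_pseudoEisenstein_indicator_kernelBorelClass_sub_borelSumClass_eq
    {cl : (quasiSplit F E c 3).arithmeticSubgroup → ι} (hcl : IsConjInvariant cl)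
    (hclN : IsUnipotentInvariantOnBorel F E c 3 cl) (ν : Measure (adelicUnipotent F E c 3)) [ν.IsHaarMeasure]
    {𝓕 : Set (adelicUnipotent F E c 3)} (h𝓕 : IsFundamentalDomain (rationalUnipotent F E c 3) 𝓕 ν) (i : ι)
    {f : (quasiSplit F E c 3).Adelic → ℂ} {c₀ : ℝ≥0}
    (hc₀ : ∀ g : (quasiSplit F E c 3).Adelic, c₀ < borelHeight g → kernelClass cl i f g g = borelSumClass cl i f g g)
    {T : ℝ≥0} (hT : 1 ≤ T) (hTc : c₀ ≤ T) (x : (quasiSplit F E c 3).automorphicQuotient) :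
    (quasiSplit F E c 3).quotFun (pseudoEisenstein ({y : (quasiSplit F E c 3).Adelic | T < borelHeight y}.indicator
        (fun y => kernelBorelClass ν 𝓕 cl i f y y - borelSumClass cl i f y y))) x =
      -{x : (quasiSplit F E c 3).automorphicQuotient | ∃ γ : (quasiSplit F E c 3).arithmeticSubgroup,
          T < borelHeight ((γ : (quasiSplit F E c 3).Adelic) *
            (Quotient.out (x : (quasiSplit F E c 3).Adelic ⧸ (quasiSplit F E c 3).quotientSubgroup))⁻¹)}.indicator
        ((quasiSplit F E c 3).quotFun (truncatedKernelClass ν 𝓕 T cl i f)) x := by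
  set SG : Set (quasiSplit F E c 3).Adelic := {x | ∃ γ : (quasiSplit F E c 3).arithmeticSubgroup,
    T < borelHeight ((γ : (quasiSplit F E c 3).Adelic) * x)} with hSG
  set SQ : Set (quasiSplit F E c 3).automorphicQuotient := {x | ∃ γ : (quasiSplit F E c 3).arithmeticSubgroup,
    T < borelHeight ((γ : (quasiSplit F E c 3).Adelic) *
      (Quotient.out (x : (quasiSplit F E c 3).Adelic ⧸ (quasiSplit F E c 3).quotientSubgroup))⁻¹)} with hSQ
  change pseudoEisenstein _ (Quotient.out (x : (quasiSplit F E c 3).Adelic ⧸ (quasiSplit F E c 3).quotientSubgroup))⁻¹ = _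
  rw [pseudoEisenstein_indicator_kernelBorelClass_sub_borelSumClass_eq hcl hclN ν h𝓕 i hc₀ hT hTc]
  by_cases hx : x ∈ SQ
  · rw [Set.indicator_of_mem (show (Quotient.out (x : (quasiSplit F E c 3).Adelic ⧸
        (quasiSplit F E c 3).quotientSubgroup))⁻¹ ∈ SG from hx), Set.indicator_of_mem hx]
    rfl
  · rw [Set.indicator_of_notMem (show (Quotient.out (x : (quasiSplit F E c 3).Adelic ⧸
        (quasiSplit F E c 3).quotientSubgroup))⁻¹ ∉ SG from hx), Set.indicator_of_notMem hx]

end General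

/-! ## §2 Measurability of the cusp set and of the descended remainder -/

section Measurable

variable [MeasurableSpace (quasiSplit F E c N).Adelic] [BorelSpace (quasiSplit F E c N).Adelic]

/-- The cusp set `{x | ∃ γ ∈ G(F), T < H(γx)} = ⋃_{γ ∈ G(F)} γ⁻¹ · {T < H}` is Borel (`G(F)` countable, `H`
continuous ★ `measurableSet_setOf_lt_borelHeight`). [cite: Gelbart1975, §9.B] -/
theorem measurableSet_setOf_exists_lt_borelHeight_mul [NeZero N] (T : ℝ≥0) :
    MeasurableSet {x : (quasiSplit F E c N).Adelic | ∃ γ : (quasiSplit F E c N).arithmeticSubgroup,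
      T < borelHeight ((γ : (quasiSplit F E c N).Adelic) * x)} := by
  haveI := countable_arithmeticSubgroup₁₂ (F := F) (E := E) (c := c) (N := N)
  have heq : {x : (quasiSplit F E c N).Adelic | ∃ γ : (quasiSplit F E c N).arithmeticSubgroup,
      T < borelHeight ((γ : (quasiSplit F E c N).Adelic) * x)} =
      ⋃ γ : (quasiSplit F E c N).arithmeticSubgroup,
        (fun x : (quasiSplit F E c N).Adelic => (γ : (quasiSplit F E c N).Adelic) * x) ⁻¹'
          {y : (quasiSplit F E c N).Adelic | T < borelHeight y} := by
    ext x
    simp only [Set.mem_setOf_eq, Set.mem_iUnion, Set.mem_preimage]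
  rw [heq]
  exact MeasurableSet.iUnion fun γ => (measurableSet_setOf_lt_borelHeight T).preimage (measurable_const_mul _)

end Measurable

section MeasurableThree

variable [MeasurableSpace (adelicUnipotent F E c 3)] [BorelSpace (adelicUnipotent F E c 3)]
  [MeasurableSpace (quasiSplit F E c 3).Adelic] [BorelSpace (quasiSplit F E c 3).Adelic]

/-- **The descended remainder `[g] ↦ R_T(g⁻¹)` is Borel on `G(𝔸_F) ⧸ G(F)`** for continuous `f`, `T ≥ 1` above the
Borel-collapse threshold `c₀`, a Haar measure `ν` of `N(𝔸_F)`, a fundamental domain `𝓕` of `N(F)` and a class map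
with Rogawski's two axioms: by §1 its lift to `G(𝔸_F)` is `g ↦ −1_{cusp}(g⁻¹) k^T_𝔬(g⁻¹)`, Borel by
`measurableSet_setOf_exists_lt_borelHeight_mul` and ★ `measurable_truncatedKernelClass`; measurability descends
along the closed `G(F)` (★ `measurable_quotient_iff`). [cite: Rogawski1990, §2.2 (p. 13)] -/
theorem measurable_quotFun_pseudoEisenstein_indicator_kernelBorelClass_sub_borelSumClass
    {cl : (quasiSplit F E c 3).arithmeticSubgroup → ι} (hcl : IsConjInvariant cl)
    (hclN : IsUnipotentInvariantOnBorel F E c 3 cl) {f : (quasiSplit F E c 3).Adelic → ℂ} (hf : Continuous f)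
    (ν : Measure (adelicUnipotent F E c 3)) [ν.IsHaarMeasure]
    {𝓕 : Set (adelicUnipotent F E c 3)} (h𝓕 : IsFundamentalDomain (rationalUnipotent F E c 3) 𝓕 ν) (i : ι)
    {c₀ : ℝ≥0}
    (hc₀ : ∀ g : (quasiSplit F E c 3).Adelic, c₀ < borelHeight g → kernelClass cl i f g g = borelSumClass cl i f g g)
    {T : ℝ≥0} (hT : 1 ≤ T) (hTc : c₀ ≤ T) :
    Measurable ((quasiSplit F E c 3).quotFun (pseudoEisenstein
      ({y : (quasiSplit F E c 3).Adelic | T < borelHeight y}.indicator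
        (fun y => kernelBorelClass ν 𝓕 cl i f y y - borelSumClass cl i f y y)))) := by
  haveI := secondCountableTopology_adeleRing E
  haveI := locallyCompactSpace_adeleRing' E
  haveI : T2Space (quasiSplit F E c 3).Adelic :=
    inferInstanceAs (T2Space (adelic F E c 3 ((StdForm.antidiagonal 3).over E)))
  haveI : LocallyCompactSpace (quasiSplit F E c 3).Adelic :=
    inferInstanceAs (LocallyCompactSpace (adelic F E c 3 ((StdForm.antidiagonal 3).over E)))
  haveI : SecondCountableTopology (quasiSplit F E c 3).Adelic :=
    inferInstanceAs (SecondCountableTopology (adelic F E c 3 ((StdForm.antidiagonal 3).over E)))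
  haveI : T2Space (AdeleRing (𝓞 E) E) := t2Space_adeleRing_E₁₂ (E := E)
  haveI : LocallyCompactSpace (adelicUnipotent F E c 3) := by
    have hcl' : IsClosed ((adelicUnipotent F E c 3 : Set (quasiSplit F E c 3).Adelic)) := by
      change IsClosed (⇑(adelicVal F E c 3 ((StdForm.antidiagonal 3).over E)) ⁻¹'
        ((upperUnitriangular (Fin 3) (AdeleRing (𝓞 E) E) : Subgroup (GL (Fin 3) (AdeleRing (𝓞 E) E))) :
          Set (GL (Fin 3) (AdeleRing (𝓞 E) E))))
      exact (isClosed_upperUnitriangular (R := AdeleRing (𝓞 E) E)).preimage continuous_subtype_val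
    exact hcl'.locallyCompactSpace
  haveI : SecondCountableTopology (adelicUnipotent F E c 3) :=
    TopologicalSpace.Subtype.secondCountableTopology _
  letI : MeasurableSpace ((quasiSplit F E c 3).Adelic ⧸ (quasiSplit F E c 3).quotientSubgroup) :=
    (quasiSplit F E c 3).instMeasurableSpaceAutomorphicQuotient
  haveI : BorelSpace ((quasiSplit F E c 3).Adelic ⧸ (quasiSplit F E c 3).quotientSubgroup) :=
    (quasiSplit F E c 3).instBorelSpaceAutomorphicQuotient
  have hT0 : 0 < T := lt_of_lt_of_le one_pos hT
  -- the lift to `G(𝔸_F)`: `g ↦ −1_{cusp}(g⁻¹) · k^T_𝔬(g⁻¹)`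
  set Φ : (quasiSplit F E c 3).Adelic → ℂ := fun g =>
    -{x : (quasiSplit F E c 3).Adelic | ∃ γ : (quasiSplit F E c 3).arithmeticSubgroup,
        T < borelHeight ((γ : (quasiSplit F E c 3).Adelic) * x)}.indicator (truncatedKernelClass ν 𝓕 T cl i f) g⁻¹
    with hΦ
  have hΦm : Measurable Φ :=
    (((measurable_truncatedKernelClass hf ν 𝓕 hT0 cl i).indicator
      (measurableSet_setOf_exists_lt_borelHeight_mul T)).comp measurable_inv).neg
  have hmeas := (Literature.MeasureTheory.Group.measurable_quotient_iff
    (G := (quasiSplit F E c 3).Adelic) (H := (quasiSplit F E c 3).quotientSubgroup)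
    isClosed_quotientSubgroup_quasiSplit
    (F := (quasiSplit F E c 3).quotFun (pseudoEisenstein
      ({y : (quasiSplit F E c 3).Adelic | T < borelHeight y}.indicator
        (fun y => kernelBorelClass ν 𝓕 cl i f y y - borelSumClass cl i f y y))))).2
  have heq : (quasiSplit F E c 3).quotFun (pseudoEisenstein
      ({y : (quasiSplit F E c 3).Adelic | T < borelHeight y}.indicator
        (fun y => kernelBorelClass ν 𝓕 cl i f y y - borelSumClass cl i f y y))) ∘
      (QuotientGroup.mk : (quasiSplit F E c 3).Adelic →
        (quasiSplit F E c 3).Adelic ⧸ (quasiSplit F E c 3).quotientSubgroup) = Φ := by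
    funext g
    simp only [Function.comp_apply, hΦ]
    -- `out [g] = g γ` for some `γ ∈ G(F)`; both the cusp set and `k^T_𝔬` are left `G(F)`-invariant
    obtain ⟨γ, hγ⟩ := QuotientGroup.mk_out_eq_mul (quasiSplit F E c 3).quotientSubgroup g
    have hγ' : ((γ : (quasiSplit F E c 3).Adelic))⁻¹ ∈ (quasiSplit F E c 3).arithmeticSubgroup := by
      have h : (quasiSplit F E c 3).quotientSubgroup = (quasiSplit F E c 3).arithmeticSubgroup := by
        rw [AdelicGroupData.quotientSubgroup, show (quasiSplit F E c 3).center' = ⊥ from rfl, bot_sup_eq]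
      rw [← h]
      exact inv_mem γ.2
    change pseudoEisenstein _ (Quotient.out (QuotientGroup.mk g : (quasiSplit F E c 3).Adelic ⧸
      (quasiSplit F E c 3).quotientSubgroup))⁻¹ = _
    rw [pseudoEisenstein_indicator_kernelBorelClass_sub_borelSumClass_eq hcl hclN ν h𝓕 i hc₀ hT hTc, hγ, mul_inv_rev]
    have hinv := exists_lt_borelHeight_rational_mul_iff (N := 3) T ⟨_, hγ'⟩ g⁻¹
    have hk := truncatedKernelClass_rational_mul' hcl hclN ν h𝓕 T i f ⟨_, hγ'⟩ g⁻¹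
    set SG : Set (quasiSplit F E c 3).Adelic := {x | ∃ γ : (quasiSplit F E c 3).arithmeticSubgroup,
      T < borelHeight ((γ : (quasiSplit F E c 3).Adelic) * x)} with hSG
    by_cases hg : g⁻¹ ∈ SG
    · rw [Set.indicator_of_mem hg, Set.indicator_of_mem (show ((γ : (quasiSplit F E c 3).Adelic))⁻¹ * g⁻¹ ∈ SG
          from hinv.2 hg), hk]
    · rw [Set.indicator_of_notMem hg, Set.indicator_of_notMem (show ((γ : (quasiSplit F E c 3).Adelic))⁻¹ * g⁻¹ ∉ SG
          from fun h => hg (hinv.1 h))]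
  exact hmeas (heq ▸ hΦm)

/-! ## §3 (W2-b)(i): integrability of the descended remainder -/

/-- **(W2-b)(i) — `[g] ↦ R_T(g⁻¹)` IS `μ`-INTEGRABLE WHENEVER `[g] ↦ k^T_𝔬(g⁻¹)` IS** (`U(J₃)`; continuous `f`, a
class map with Rogawski's two axioms, `ν` Haar on `N(𝔸_F)`, `𝓕` a fundamental domain of `N(F)`, `T ≥ 1` above the
Borel-collapse threshold `c₀`, any measure `μ` on the automorphic quotient): by the collapse §1,
`‖R_T(g⁻¹)‖ ≤ ‖k^T_𝔬(g⁻¹)‖` pointwise, and the descended remainder is Borel (§2) — so no cusp estimate is replayed: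
the integrability of `k^T_𝔬` ([Arthur1978] Thm. 7.1; ★ `truncatedKernelClassIntegrable_cm`) carries over.
[cite: Rogawski1990, §2.2 (p. 13); §6.1 (pp. 79–81)] [cite: Arthur1978TraceFormulaI, Thm. 7.1, §8] -/
theorem integrable_quotFun_pseudoEisenstein_indicator_of_integrable
    {cl : (quasiSplit F E c 3).arithmeticSubgroup → ι} (hcl : IsConjInvariant cl)
    (hclN : IsUnipotentInvariantOnBorel F E c 3 cl) {f : (quasiSplit F E c 3).Adelic → ℂ} (hf : Continuous f)
    (ν : Measure (adelicUnipotent F E c 3)) [ν.IsHaarMeasure]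
    {𝓕 : Set (adelicUnipotent F E c 3)} (h𝓕 : IsFundamentalDomain (rationalUnipotent F E c 3) 𝓕 ν) (i : ι)
    {c₀ : ℝ≥0}
    (hc₀ : ∀ g : (quasiSplit F E c 3).Adelic, c₀ < borelHeight g → kernelClass cl i f g g = borelSumClass cl i f g g)
    {T : ℝ≥0} (hT : 1 ≤ T) (hTc : c₀ ≤ T) {μ : Measure (quasiSplit F E c 3).automorphicQuotient}
    (hint : Integrable ((quasiSplit F E c 3).quotFun (truncatedKernelClass ν 𝓕 T cl i f)) μ) :
    Integrable ((quasiSplit F E c 3).quotFun (pseudoEisenstein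
      ({y : (quasiSplit F E c 3).Adelic | T < borelHeight y}.indicator
        (fun y => kernelBorelClass ν 𝓕 cl i f y y - borelSumClass cl i f y y)))) μ := by
  refine Integrable.mono hint
    (measurable_quotFun_pseudoEisenstein_indicator_kernelBorelClass_sub_borelSumClass hcl hclN hf ν h𝓕 i hc₀ hT
      hTc).aestronglyMeasurable (Filter.Eventually.of_forall fun x => ?_)
  rw [quotFun_pseudoEisenstein_indicator_kernelBorelClass_sub_borelSumClass_eq hcl hclN ν h𝓕 i hc₀ hT hTc x, norm_neg]
  exact norm_indicator_le_norm_self _ _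

/-- **(W2-b)(i) AT THE CM PAIR `(L⁺, L, complexConj)`, HYPOTHESIS-FREE**: for the quasi-split `U(J₃)` attached to a
CM field `L`, every conjugation-invariant `N(F)`-saturated class map `cl`, every Haar measure `ν` of `N(𝔸)`,
fundamental domain `𝓕` of `N(F)`, automorphic measure `μ`, TEST function `f` (★ `IsQuasiSplitTest`) and class `𝔬`,
there is `T₁` such that for all `T > T₁` the descended lattice-sum remainder
`[g] ↦ R_T(g⁻¹) = Σ_{δ ∈ B(F)\G(F)} 1_{T<H(δg⁻¹)} (K_{B,𝔬} − Σ_{B(F)∩𝔬̲})(δg⁻¹)` is `μ`-integrable — ★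
`truncatedKernelClassIntegrable_cm` + the Borel-collapse threshold of ★
`exists_forall_kernelClass_eq_borelSumClass_of_lt_borelHeight` + the previous theorem.
[cite: Rogawski1990, §2.2 (p. 13); §6.1 (pp. 79–81)] [cite: Arthur1978TraceFormulaI, Thm. 7.1, §8] -/
theorem integrable_quotFun_pseudoEisenstein_indicator_cm (L : Type) [Field L] [NumberField L] [IsCMField L]
    {κ : Type*}
    {cl : (quasiSplit (↥(maximalRealSubfield L)) L (IsCMField.complexConj L) 3).arithmeticSubgroup → κ}
    (hcl : IsConjInvariant cl)
    (hclN : IsUnipotentInvariantOnBorel (↥(maximalRealSubfield L)) L (IsCMField.complexConj L) 3 cl) :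
    ∀ [MeasurableSpace (adelicUnipotent (↥(maximalRealSubfield L)) L (IsCMField.complexConj L) 3)]
      [BorelSpace (adelicUnipotent (↥(maximalRealSubfield L)) L (IsCMField.complexConj L) 3)]
      [MeasurableSpace (quasiSplit (↥(maximalRealSubfield L)) L (IsCMField.complexConj L) 3).Adelic]
      [BorelSpace (quasiSplit (↥(maximalRealSubfield L)) L (IsCMField.complexConj L) 3).Adelic]
      (ν : Measure (adelicUnipotent (↥(maximalRealSubfield L)) L (IsCMField.complexConj L) 3)) [ν.IsHaarMeasure]
      (𝓕 : Set (adelicUnipotent (↥(maximalRealSubfield L)) L (IsCMField.complexConj L) 3)),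
      IsFundamentalDomain (rationalUnipotent (↥(maximalRealSubfield L)) L (IsCMField.complexConj L) 3) 𝓕 ν →
        ∀ (μ : Measure (quasiSplit (↥(maximalRealSubfield L)) L (IsCMField.complexConj L) 3).automorphicQuotient)
          [(quasiSplit (↥(maximalRealSubfield L)) L (IsCMField.complexConj L) 3).IsAutomorphicMeasure μ]
          (f : (quasiSplit (↥(maximalRealSubfield L)) L (IsCMField.complexConj L) 3).Adelic → ℂ),
          IsQuasiSplitTest (↥(maximalRealSubfield L)) L (IsCMField.complexConj L) 3 f →
          ∀ i : κ, ∃ T₁ : ℝ≥0, 1 ≤ T₁ ∧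
            (∀ g : (quasiSplit (↥(maximalRealSubfield L)) L (IsCMField.complexConj L) 3).Adelic, T₁ < borelHeight g →
              kernelClass cl i f g g = borelSumClass cl i f g g) ∧
            ∀ T : ℝ≥0, T₁ < T →
              Integrable ((quasiSplit (↥(maximalRealSubfield L)) L (IsCMField.complexConj L) 3).quotFun
                (truncatedKernelClass ν 𝓕 T cl i f)) μ ∧
              Integrable ((quasiSplit (↥(maximalRealSubfield L)) L (IsCMField.complexConj L) 3).quotFun
                (pseudoEisenstein ({y : (quasiSplit (↥(maximalRealSubfield L)) L (IsCMField.complexConj L) 3).Adelic |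
                    T < borelHeight y}.indicator
                  (fun y => kernelBorelClass ν 𝓕 cl i f y y - borelSumClass cl i f y y)))) μ := by
  intro _ _ _ _ ν _ 𝓕 h𝓕 μ _ f hf i
  obtain ⟨T₀, hT₀⟩ := truncatedKernelClassIntegrable_cm L hcl hclN ν 𝓕 h𝓕 μ f hf i
  obtain ⟨c₀, hc₀⟩ := exists_forall_kernelClass_eq_borelSumClass_of_lt_borelHeight (ι := κ) hf.hasCompactSupport'
  refine ⟨max T₀ (max 1 c₀), le_max_of_le_right (le_max_left _ _),
    fun g hg => hc₀ cl i g ((le_max_of_le_right (le_max_right _ _)).trans_lt hg), fun T hT => ?_⟩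
  have hT₀T : T₀ < T := (le_max_left _ _).trans_lt hT
  have h1T : 1 ≤ T := ((le_max_of_le_right (le_max_left _ _)).trans_lt hT).le
  have hcT : c₀ ≤ T := ((le_max_of_le_right (le_max_right _ _)).trans_lt hT).le
  exact ⟨hT₀ T hT₀T, integrable_quotFun_pseudoEisenstein_indicator_of_integrable hcl hclN hf.continuous' ν h𝓕 i
    (hc₀ cl i) h1T hcT (hT₀ T hT₀T)⟩

/-! ## §4 `J^T_𝔬(f) = ∫ 1_{H^G ≤ T} K_𝔬 − ∫ R_T` -/

/-- **`J^T_𝔬(f)` IS THE NAIVELY TRUNCATED CLASS KERNEL MINUS THE INTEGRAL OF THE REMAINDER**: for `U(J₃)`, a class map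
with Rogawski's two axioms, `ν` Haar on `N(𝔸_F)`, `𝓕` a fundamental domain of `N(F)`, continuous `f`, `T ≥ 1` above
the Borel-collapse threshold `c₀`, and a measure `μ` on `G(𝔸_F) ⧸ G(F)` for which `[g] ↦ k^T_𝔬(g⁻¹)` is
integrable:
`J^T_𝔬(f) = ∫ 1_{∀ γ, H(γ g⁻¹) ≤ T} K_𝔬(g⁻¹, g⁻¹) dμ[g] − ∫ R_T(g⁻¹) dμ[g]` — below the cut-off `k^T_𝔬 = K_𝔬` (★
`truncatedKernelClass_eq_kernelClass_of_forall_le`), above it `k^T_𝔬 = −R_T` (§1). So «`∫ R_T = 0`» ((W2-b)(ii),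
sequel, for `N`-regular classes) says exactly that the naive truncation computes Arthur's `J^T_𝔬(f)`
([Rogawski1990] §6.1: for a regular hyperbolic class `J^T_𝔬(f)` is the truncated-domain integral leading to
(6.1.3)). [cite: Rogawski1990, §2.2 (p. 13); §6.1 (pp. 79–81)] [cite: Arthur1978TraceFormulaI, §8] -/
theorem truncatedTraceClass_eq_integral_indicator_sub_integral_pseudoEisenstein
    {cl : (quasiSplit F E c 3).arithmeticSubgroup → ι} (hcl : IsConjInvariant cl)
    (hclN : IsUnipotentInvariantOnBorel F E c 3 cl) {f : (quasiSplit F E c 3).Adelic → ℂ} (hf : Continuous f)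
    (ν : Measure (adelicUnipotent F E c 3)) [ν.IsHaarMeasure]
    {𝓕 : Set (adelicUnipotent F E c 3)} (h𝓕 : IsFundamentalDomain (rationalUnipotent F E c 3) 𝓕 ν) (i : ι)
    {c₀ : ℝ≥0}
    (hc₀ : ∀ g : (quasiSplit F E c 3).Adelic, c₀ < borelHeight g → kernelClass cl i f g g = borelSumClass cl i f g g)
    {T : ℝ≥0} (hT : 1 ≤ T) (hTc : c₀ ≤ T) (μ : Measure (quasiSplit F E c 3).automorphicQuotient)
    (hint : Integrable ((quasiSplit F E c 3).quotFun (truncatedKernelClass ν 𝓕 T cl i f)) μ) :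
    truncatedTraceClass μ ν 𝓕 T cl i f =
      (∫ x, {x : (quasiSplit F E c 3).automorphicQuotient | ∃ γ : (quasiSplit F E c 3).arithmeticSubgroup,
          T < borelHeight ((γ : (quasiSplit F E c 3).Adelic) *
            (Quotient.out (x : (quasiSplit F E c 3).Adelic ⧸ (quasiSplit F E c 3).quotientSubgroup))⁻¹)}ᶜ.indicator
          ((quasiSplit F E c 3).quotFun (fun g => kernelClass cl i f g g)) x ∂μ) -
      ∫ x, (quasiSplit F E c 3).quotFun (pseudoEisenstein
        ({y : (quasiSplit F E c 3).Adelic | T < borelHeight y}.indicator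
          (fun y => kernelBorelClass ν 𝓕 cl i f y y - borelSumClass cl i f y y))) x ∂μ := by
  set S : Set (quasiSplit F E c 3).automorphicQuotient := {x | ∃ γ : (quasiSplit F E c 3).arithmeticSubgroup,
    T < borelHeight ((γ : (quasiSplit F E c 3).Adelic) *
      (Quotient.out (x : (quasiSplit F E c 3).Adelic ⧸ (quasiSplit F E c 3).quotientSubgroup))⁻¹)} with hS
  -- pointwise: `k^T_𝔬 = 1_{Sᶜ} K_𝔬 + 1_S k^T_𝔬 = 1_{Sᶜ} K_𝔬 − R_T` on the quotient
  have hpt : ∀ x : (quasiSplit F E c 3).automorphicQuotient,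
      (quasiSplit F E c 3).quotFun (truncatedKernelClass ν 𝓕 T cl i f) x =
        Sᶜ.indicator ((quasiSplit F E c 3).quotFun (fun g => kernelClass cl i f g g)) x -
        (quasiSplit F E c 3).quotFun (pseudoEisenstein
          ({y : (quasiSplit F E c 3).Adelic | T < borelHeight y}.indicator
            (fun y => kernelBorelClass ν 𝓕 cl i f y y - borelSumClass cl i f y y))) x := by
    intro x
    rw [quotFun_pseudoEisenstein_indicator_kernelBorelClass_sub_borelSumClass_eq hcl hclN ν h𝓕 i hc₀ hT hTc x, ← hS,
      sub_neg_eq_add]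
    by_cases hx : x ∈ S
    · rw [Set.indicator_of_notMem (Set.notMem_compl_iff.2 hx), Set.indicator_of_mem hx, zero_add]
    · rw [Set.indicator_of_mem (Set.mem_compl hx), Set.indicator_of_notMem hx, add_zero]
      -- below the cut-off everywhere: `k^T_𝔬(g⁻¹) = K_𝔬(g⁻¹, g⁻¹)`
      have hle : ∀ γ : (quasiSplit F E c 3).arithmeticSubgroup,
          borelHeight ((γ : (quasiSplit F E c 3).Adelic) *
            (Quotient.out (x : (quasiSplit F E c 3).Adelic ⧸ (quasiSplit F E c 3).quotientSubgroup))⁻¹) ≤ T :=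
        fun γ => not_lt.1 fun h => hx ⟨γ, h⟩
      exact truncatedKernelClass_eq_kernelClass_of_forall_le cl i f hle
  -- the two pieces are integrable: `1_{Sᶜ} K_𝔬 = k^T_𝔬 + R_T`
  have hR := integrable_quotFun_pseudoEisenstein_indicator_of_integrable hcl hclN hf ν h𝓕 i hc₀ hT hTc hint
  have hK : Integrable (Sᶜ.indicator ((quasiSplit F E c 3).quotFun (fun g => kernelClass cl i f g g))) μ := by
    have heq : Sᶜ.indicator ((quasiSplit F E c 3).quotFun (fun g => kernelClass cl i f g g)) =
        fun x => (quasiSplit F E c 3).quotFun (truncatedKernelClass ν 𝓕 T cl i f) x +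
          (quasiSplit F E c 3).quotFun (pseudoEisenstein
            ({y : (quasiSplit F E c 3).Adelic | T < borelHeight y}.indicator
              (fun y => kernelBorelClass ν 𝓕 cl i f y y - borelSumClass cl i f y y))) x := by
      funext x
      rw [hpt x, sub_add_cancel]
    rw [heq]
    exact hint.add hR
  rw [truncatedTraceClass_def, integral_congr_ae (Filter.Eventually.of_forall hpt), integral_sub hK hR]

end MeasurableThree

end UnitaryGroup

end Literature.NumberTheory.Automorphic

end
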